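import Mathlib
import Summits.KontsevichZagierPeriods.Zeta5Search.ClusterValuation
import Summits.KontsevichZagierPeriods.Zeta5Search.PalindromicClassBounds
import Summits.KontsevichZagierPeriods.Zeta5Search.DenomLaw.ThresholdModelConfig

/-!
# ζ(5) search — DENOM-LAW: the threshold model, PART IV (the level configuration of a dominant class), part B: the net exponent of `R_b` along a dominant class

Cell `pub-zeta5`, track DENOM-LAW (K1 typing order item (1), «ThresholdModel port»): denom-engine-d2 g14's kernel-checked scratch module
`denom-law/engine-d2/g14/lean/LevelCensusConfig.lean` PART IV (THRESHOLD-X6) filed VERBATIM in four parts (≤ 400 lines each; docstrings added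
where the scratch file had none) by denom-prover-d1 g5.  Part B of 4.
HONEST FRAMING: systematic search; MODEL/structure side — the level configuration of a dominant class identified with the tree's `classConfig`/`IsPalindromic` and the rung-M/K coefficient rows in closed form; nothing about ζ(5); no γ; no irrationality claim; records in print UNMOVED.
The mathematical header of PART IV is the second module docstring of part A (`ThresholdModelConfig.lean`).
-/

namespace Summit.KontsevichZagierPeriods.Zeta5Search.DenomLaw.ThresholdModel.Rho

section Config

open Summit.KontsevichZagierPeriods.Zeta5Search.ClusterValuation
  (blockCount netExp classSet classExp CentreIn classPoleCount HasPoleOfOrder classConfig IsPalindromic classBound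
    GoodClasses)

/-! ### (X6-1) the net exponent of `R_b` along a dominant class, level by level -/

/-- the NET EXPONENT of the tree's `R_b` ALONG A DOMINANT CLASS, level by level, in closed form: the merged even centre
`[d(ℓ,u) = 0]`, minus the symmetric pattern `T_m(ℓ)`, plus the excess `L, R, n₊, n₋` at the levels `m−1, 2m−1, 3m−1, −1`
(Part II's `dominant_excess_eq`). -/
def domNetExp (p R0 m : ℤ) (r : Fin 7 → ℤ) (ℓ u : ℤ) : ℤ :=
  indic (dpos p m ℓ u = 0) - Tsym m ℓ
    + (if ℓ = m - 1 then L p r u else if ℓ = 2 * m - 1 then R p r u else if ℓ = 3 * m - 1 then np p R0 u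
      else if ℓ = -1 then nm p R0 u else 0)

section DomNet
variable {p R0 m ℓ u : ℤ} {r : Fin 7 → ℤ}

/-- INSIDE the pole frame, `m ≤ ℓ ≤ 2m − 2`: `−6 + [d(ℓ,u) = 0]` (order 6, or 5 at the merged even centre). -/
theorem domNetExp_interior (h0 : m ≤ ℓ) (h1 : ℓ ≤ 2 * m - 2) :
    domNetExp p R0 m r ℓ u = indic (dpos p m ℓ u = 0) - 6 := by
  unfold domNetExp
  rw [Tsym_pole (by omega) (by omega), if_neg (by omega), if_neg (by omega), if_neg (by omega), if_neg (by omega)]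
  ring

/-- adding three doubled positions of one class: `d(a) + d(c) − d(e) = d(ℓ)` forces `ℓ = a + c − e`. -/
theorem level_of_dpos_eq (hp : 1 ≤ p) {a c e : ℤ} (h : dpos p m a u + dpos p m c u - dpos p m e u = dpos p m ℓ u) :
    ℓ = a + c - e := by
  unfold dpos at h
  have h0 : p * (2 * (a + c - e) - 2 * ℓ) = 0 := by linear_combination h
  rcases mul_eq_zero.1 h0 with h1 | h1 <;> omega

/-- the reflection `ℓ ↦ 3m − 2 − ℓ` on doubled positions: `d(3m−2−ℓ, u) = −d(ℓ,u) − 2u`. -/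
theorem dpos_reflect (p m ℓ u : ℤ) : dpos p m (3 * m - 2 - ℓ) u = -dpos p m ℓ u - 2 * u := by
  unfold dpos; ring

namespace DeepCell

/-- `[d = 0] − ord(ℓ,u) = domNetExp(ℓ,u)` along a dominant class. -/
theorem netE_of_dominant (h : DeepCell p R0 r) (hd : IsDominant p R0 r u) (hm : 1 ≤ m) (ℓ : ℤ) :
    indic (dpos p m ℓ u = 0) - ord p R0 m r ℓ u = domNetExp p R0 m r ℓ u := by
  have e := h.dominant_excess_eq hd hm ℓ
  unfold excess at e
  unfold domNetExp
  linarith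

/-- at the LOW EDGE `ℓ = m − 1`: `L − 6` (a pole of order `6 − L ≥ 2`). -/
theorem domNetExp_lowEdge (h : DeepCell p R0 r) (hd : IsDominant p R0 r u) (hm : 1 ≤ m) :
    domNetExp p R0 m r (m - 1) u = L p r u - 6 := by
  have hu1 := hd.1.1
  have hp := h.three_le_p
  unfold domNetExp
  rw [indic_neg, Tsym_pole (le_refl _) (by omega), if_pos rfl]
  · ring
  · intro h0
    unfold dpos at h0
    have e : p * (2 * (m - 1) - 3 * m + 2) = -(p * m) := by ring
    rw [e] at h0
    have : p ≤ p * m := by nlinarith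
    linarith

/-- at the HIGH EDGE `ℓ = 2m − 1`: `R − 6` (uses `u < p`: the merged centre never sits on an edge of a dominant class). -/
theorem domNetExp_highEdge (h : DeepCell p R0 r) (hd : IsDominant p R0 r u) (hm : 1 ≤ m) :
    domNetExp p R0 m r (2 * m - 1) u = R p r u - 6 := by
  have hu2 := h.lt_p_of_dominant hd
  have hp := h.three_le_p
  unfold domNetExp
  rw [indic_neg, Tsym_pole (by omega) (le_refl _), if_neg (by omega), if_pos rfl]
  · ring
  · intro h0
    unfold dpos at h0
    have e : p * (2 * (2 * m - 1) - 3 * m + 2) = p * m := by ring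
    rw [e] at h0
    have : p ≤ p * m := by nlinarith
    linarith

/-- on the ZERO FRAME, and at the extra numerator levels `−1` / `3m − 1` when they belong to the class: a simple ZERO, `+1`. -/
theorem domNetExp_eq_one (h : DeepCell p R0 r) (hd : IsDominant p R0 r u) (hm : 1 ≤ m)
    (hℓ : (0 ≤ ℓ ∧ ℓ ≤ m - 2) ∨ (2 * m ≤ ℓ ∧ ℓ ≤ 3 * m - 2) ∨ (ℓ = -1 ∧ nm p R0 u = 1) ∨
      (ℓ = 3 * m - 1 ∧ np p R0 u = 1)) :
    domNetExp p R0 m r ℓ u = 1 := by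
  have hz : indic (dpos p m ℓ u = 0) = 0 :=
    indic_neg (fun h0 => by have := (h.dpos_eq_zero_imp hd h0).2; omega)
  unfold domNetExp
  rw [hz]
  rcases hℓ with ⟨h0, h1⟩ | ⟨h0, h1⟩ | ⟨e, hn⟩ | ⟨e, hn⟩
  · rw [Tsym_zeroLo h0 h1, if_neg (by omega), if_neg (by omega), if_neg (by omega), if_neg (by omega)]; ring
  · rw [Tsym_zeroHi h0 h1, if_neg (by omega), if_neg (by omega), if_neg (by omega), if_neg (by omega)]; ring
  · subst e
    rw [Tsym_outside hm (Or.inl (le_refl _)), if_neg (by omega), if_neg (by omega), if_neg (by omega), if_pos rfl, hn]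
    ring
  · subst e
    rw [Tsym_outside hm (Or.inr (le_refl _)), if_neg (by omega), if_neg (by omega), if_pos rfl, hn]
    ring

/-- **NO NUMERATOR LEVEL OF A DOMINANT CLASS IS NEUTRAL**: `domNetExp ≠ 0` on `−n₋ ≤ ℓ ≤ 3m − 2 + n₊`. -/
theorem domNetExp_ne_zero (h : DeepCell p R0 r) (hd : IsDominant p R0 r u) (hm : 1 ≤ m)
    (hlo : -nm p R0 u ≤ ℓ) (hhi : ℓ ≤ 3 * m - 2 + np p R0 u) : domNetExp p R0 m r ℓ u ≠ 0 := by
  obtain ⟨hL4, hR4, -⟩ := h.LRnn_le_four hd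
  have hn0 : 0 ≤ nm p R0 u := indic_nonneg _
  have hn1 : nm p R0 u ≤ 1 := indic_le_one _
  have hN0 : 0 ≤ np p R0 u := indic_nonneg _
  have hN1 : np p R0 u ≤ 1 := indic_le_one _
  rcases (show (ℓ = -1 ∧ nm p R0 u = 1) ∨ (0 ≤ ℓ ∧ ℓ ≤ m - 2) ∨ ℓ = m - 1 ∨ (m ≤ ℓ ∧ ℓ ≤ 2 * m - 2) ∨
      ℓ = 2 * m - 1 ∨ (2 * m ≤ ℓ ∧ ℓ ≤ 3 * m - 2) ∨ (ℓ = 3 * m - 1 ∧ np p R0 u = 1) by omega)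
    with ⟨e, hn⟩ | ⟨h0, h1⟩ | e | ⟨h0, h1⟩ | e | ⟨h0, h1⟩ | ⟨e, hn⟩
  · rw [h.domNetExp_eq_one hd hm (Or.inr (Or.inr (Or.inl ⟨e, hn⟩)))]; norm_num
  · rw [h.domNetExp_eq_one hd hm (Or.inl ⟨h0, h1⟩)]; norm_num
  · subst e; rw [h.domNetExp_lowEdge hd hm]; omega
  · rw [domNetExp_interior h0 h1]; have := indic_le_one (dpos p m ℓ u = 0); omega
  · subst e; rw [h.domNetExp_highEdge hd hm]; omega
  · rw [h.domNetExp_eq_one hd hm (Or.inr (Or.inl ⟨h0, h1⟩))]; norm_num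
  · rw [h.domNetExp_eq_one hd hm (Or.inr (Or.inr (Or.inr ⟨e, hn⟩)))]; norm_num

/-- under the MIRROR-SYMMETRY `L = R`, `n₊ = n₋` the net exponent is invariant under the reflection `ℓ ↦ 3m − 2 − ℓ`
(the centre indicator `[d = 0]` is reflected onto itself because `d = 0` only happens for `u = 0`). -/
theorem domNetExp_reflect (h : DeepCell p R0 r) (hd : IsDominant p R0 r u) (hm : 1 ≤ m) (hLR : L p r u = R p r u)
    (hnn : np p R0 u = nm p R0 u) (ℓ : ℤ) :
    domNetExp p R0 m r (3 * m - 2 - ℓ) u = domNetExp p R0 m r ℓ u := by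
  have hc : indic (dpos p m (3 * m - 2 - ℓ) u = 0) = indic (dpos p m ℓ u = 0) := by
    refine indic_congr ⟨fun h0 => ?_, fun h0 => ?_⟩
    · have hu := (h.dpos_eq_zero_imp hd h0).1
      rw [dpos_reflect, hu] at h0
      rw [hu]; linarith
    · have hu := (h.dpos_eq_zero_imp hd h0).1
      rw [hu] at h0 ⊢
      rw [dpos_reflect, h0]; ring
  unfold domNetExp
  rw [hc, Tsym_mirror]
  by_cases c1 : ℓ = m - 1
  · subst c1
    rw [if_neg (by omega), if_pos (by omega), if_pos rfl, hLR]
  by_cases c2 : ℓ = 2 * m - 1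
  · subst c2
    rw [if_pos (by omega), if_neg (by omega), if_pos rfl, hLR]
  by_cases c3 : ℓ = 3 * m - 1
  · subst c3
    rw [if_neg (by omega), if_neg (by omega), if_neg (by omega), if_pos (by omega), if_neg (by omega),
      if_neg (by omega), if_pos rfl, hnn]
  by_cases c4 : ℓ = -1
  · subst c4
    rw [if_neg (by omega), if_neg (by omega), if_pos (by omega), if_neg (by omega), if_neg (by omega),
      if_neg (by omega), if_pos rfl, hnn]
  rw [if_neg (by omega), if_neg (by omega), if_neg (by omega), if_neg (by omega), if_neg c1, if_neg c2, if_neg c3,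
    if_neg c4]

/-- existence of a dominant class (the score attains its minimum on the finite set of classes; `u*` is a class). -/
theorem exists_dominant (h : DeepCell p R0 r) : ∃ u, IsDominant p R0 r u := by
  classical
  have hne : ((Finset.Ioc (-p) p).filter (fun u => (u - R0) % 2 = 0)).Nonempty := by
    refine ⟨utStar p R0 r, ?_⟩
    have hc := h.utStar_isClass
    simp only [Finset.mem_filter, Finset.mem_Ioc]
    exact ⟨⟨hc.1, hc.2.1⟩, hc.2.2⟩
  obtain ⟨u, huC, hmin⟩ := Finset.exists_min_image _ (score p R0 r) hne
  simp only [Finset.mem_filter, Finset.mem_Ioc] at huC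
  refine ⟨u, ⟨huC.1.1, huC.1.2, huC.2⟩, fun u' hu' => hmin u' ?_⟩
  simp only [Finset.mem_filter, Finset.mem_Ioc]
  exact ⟨⟨hu'.1, hu'.2.1⟩, hu'.2.2⟩

/-- **THE PALINDROME CRITERION, LEVEL FORM**: a finite set `S ⊆ ℤ × ℤ` consisting of the level points
`(b₀ + d(ℓ,u), domNetExp(ℓ,u))`, `−n₋ ≤ ℓ ≤ 3m−2+n₊`, of a dominant class (plus the odd centre `(b₀, 1)` when `u = 0`,
`m` odd) is palindromic in the tree's sense (`∃ M, ∀ (P,e) ∈ S, (M − P, e) ∈ S`) iff `L = R ∧ n₊ = n₋`.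
(⇒): a reflection maps the least first coordinate to the largest, so `M = P(−n₋) + P(3m−2+n₊)`; the low edge
`(P(m−1), L−6)` must land on a point of exponent `L − 6 ≤ −2`: for `n₊ = n₋` that point is the high edge (`R − 6`), for
`n₊ ≠ n₋` one of the two edges lands on a simple zero (`+1`) — impossible.  (⇐): `M = 2b₀ − 2u`, `ℓ ↦ 3m − 2 − ℓ`
(`domNetExp_reflect`), and the odd centre is fixed since then `u = 0`. -/
theorem isPalindromic_iff_levels (h : DeepCell p R0 r) (hd : IsDominant p R0 r u) (hm : 1 ≤ m) (b0 : ℤ)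
    (S : Finset (ℤ × ℤ))
    (hS : ∀ P e, (P, e) ∈ S ↔
      (∃ ℓ, -nm p R0 u ≤ ℓ ∧ ℓ ≤ 3 * m - 2 + np p R0 u ∧ P = b0 + dpos p m ℓ u ∧ e = domNetExp p R0 m r ℓ u) ∨
        (u = 0 ∧ m % 2 = 1 ∧ P = b0 ∧ e = 1)) :
    IsPalindromic S ↔ (L p r u = R p r u ∧ np p R0 u = nm p R0 u) := by
  have hp3 := h.three_le_p
  have hp1 : (1 : ℤ) ≤ p := by linarith
  have hu1 := hd.1.1
  have hup := h.lt_p_of_dominant hd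
  obtain ⟨hL4, hR4, -⟩ := h.LRnn_le_four hd
  have hn0 : 0 ≤ nm p R0 u := indic_nonneg _
  have hn1 : nm p R0 u ≤ 1 := indic_le_one _
  have hN0 : 0 ≤ np p R0 u := indic_nonneg _
  have hN1 : np p R0 u ≤ 1 := indic_le_one _
  -- level points are members; the two edges
  have memL : ∀ ℓ, -nm p R0 u ≤ ℓ → ℓ ≤ 3 * m - 2 + np p R0 u →
      (b0 + dpos p m ℓ u, domNetExp p R0 m r ℓ u) ∈ S :=
    fun ℓ h1 h2 => (hS _ _).2 (Or.inl ⟨ℓ, h1, h2, rfl, rfl⟩)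
  have memLo : (b0 + dpos p m (m - 1) u, L p r u - 6) ∈ S := by
    rw [← h.domNetExp_lowEdge hd hm]; exact memL _ (by omega) (by omega)
  have memHi : (b0 + dpos p m (2 * m - 1) u, R p r u - 6) ∈ S := by
    rw [← h.domNetExp_highEdge hd hm]; exact memL _ (by omega) (by omega)
  -- every first coordinate lies between the extreme levels
  have squeeze : ∀ P e, (P, e) ∈ S →
      b0 + dpos p m (-nm p R0 u) u ≤ P ∧ P ≤ b0 + dpos p m (3 * m - 2 + np p R0 u) u := by
    intro P e hPe
    rcases (hS P e).1 hPe with ⟨ℓ, h1, h2, hP, -⟩ | ⟨-, -, hP, -⟩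
    · rw [hP]
      unfold dpos
      constructor
      · have : p * (2 * -nm p R0 u - 3 * m + 2) ≤ p * (2 * ℓ - 3 * m + 2) :=
          mul_le_mul_of_nonneg_left (by omega) (by linarith)
        linarith
      · have : p * (2 * ℓ - 3 * m + 2) ≤ p * (2 * (3 * m - 2 + np p R0 u) - 3 * m + 2) :=
          mul_le_mul_of_nonneg_left (by omega) (by linarith)
        linarith
    · rw [hP]
      unfold dpos
      constructor
      · have : p * (2 * -nm p R0 u - 3 * m + 2) ≤ p * (-1) := mul_le_mul_of_nonneg_left (by omega) (by linarith)
        linarith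
      · have : p * 1 ≤ p * (2 * (3 * m - 2 + np p R0 u) - 3 * m + 2) :=
          mul_le_mul_of_nonneg_left (by omega) (by linarith)
        linarith
  unfold IsPalindromic
  constructor
  · rintro ⟨M, -, hM⟩
    -- the reflection swaps the extreme positions: `M = P(−n₋) + P(3m−2+n₊)`
    have a1 := hM _ (memL (-nm p R0 u) (le_refl _) (by omega))
    have a2 := hM _ (memL (3 * m - 2 + np p R0 u) (by omega) (le_refl _))
    dsimp only at a1 a2
    obtain ⟨-, a1⟩ := squeeze _ _ a1
    obtain ⟨a2, -⟩ := squeeze _ _ a2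
    have hMeq : M = (b0 + dpos p m (-nm p R0 u) u) + (b0 + dpos p m (3 * m - 2 + np p R0 u) u) := by linarith
    -- the images of the two edges
    have e1 := hM _ memLo
    have e2 := hM _ memHi
    dsimp only at e1 e2
    rw [hMeq] at e1 e2
    rcases (hS _ _).1 e1 with ⟨ℓ₁, -, -, hP1, hE1⟩ | ⟨-, -, -, hE1⟩
    swap
    · exfalso; linarith
    have hℓ1 : ℓ₁ = -nm p R0 u + (3 * m - 2 + np p R0 u) - (m - 1) := level_of_dpos_eq hp1 (by linarith)
    rcases (hS _ _).1 e2 with ⟨ℓ₂, -, -, hP2, hE2⟩ | ⟨-, -, -, hE2⟩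
    swap
    · exfalso; linarith
    have hℓ2 : ℓ₂ = -nm p R0 u + (3 * m - 2 + np p R0 u) - (2 * m - 1) := level_of_dpos_eq hp1 (by linarith)
    by_cases hnn : np p R0 u = nm p R0 u
    · have e : ℓ₁ = 2 * m - 1 := by omega
      rw [e, h.domNetExp_highEdge hd hm] at hE1
      exact ⟨by linarith, hnn⟩
    · exfalso
      rcases (show (np p R0 u = 1 ∧ nm p R0 u = 0) ∨ (np p R0 u = 0 ∧ nm p R0 u = 1) by omega) with ⟨a, c⟩ | ⟨a, c⟩
      · -- `ℓ₁ = 2m`: a zero-frame level (`m ≥ 2`) or the top level `3m − 1` (`m = 1`): net exponent `+1 ≠ L − 6`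
        have hv : domNetExp p R0 m r ℓ₁ u = 1 := h.domNetExp_eq_one hd hm (by omega)
        rw [hv] at hE1; linarith
      · -- `ℓ₂ = m − 2`: a zero-frame level (`m ≥ 2`) or the bottom level `−1` (`m = 1`): `+1 ≠ R − 6`
        have hv : domNetExp p R0 m r ℓ₂ u = 1 := h.domNetExp_eq_one hd hm (by omega)
        rw [hv] at hE2; linarith
  · rintro ⟨hLR, hnn⟩
    refine ⟨2 * b0 - 2 * u, ?_, ?_⟩
    · refine Finset.mem_image.2 ⟨((b0 + dpos p m (m - 1) u, L p r u - 6), (b0 + dpos p m (2 * m - 1) u, R p r u - 6)),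
        Finset.mem_product.2 ⟨memLo, memHi⟩, ?_⟩
      dsimp only
      unfold dpos; ring
    · rintro ⟨P, e⟩ hPe
      dsimp only
      rcases (hS P e).1 hPe with ⟨ℓ, l1, l2, hP, hE⟩ | ⟨h0, hmo, hP, hE⟩
      · refine (hS _ _).2 (Or.inl ⟨3 * m - 2 - ℓ, by omega, by omega, ?_, ?_⟩)
        · rw [hP, dpos_reflect]; ring
        · rw [hE, h.domNetExp_reflect hd hm hLR hnn]
      · refine (hS _ _).2 (Or.inr ⟨h0, hmo, ?_, hE⟩)
        rw [hP, h0]; ring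

end DeepCell

end DomNet

end Config

end Summit.KontsevichZagierPeriods.Zeta5Search.DenomLaw.ThresholdModel.Rho
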